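import Literature.MathematicalPhysics.QuantumLattice.TubeBoostReflectionN
import Literature.MathematicalPhysics.QuantumLattice.TubeBoundaryValueLocal
import Literature.MathematicalPhysics.QuantumLattice.WightmanPermutedTube
import Mathlib.Analysis.Distribution.AEEqOfIntegralContDiff
import Mathlib.MeasureTheory.Measure.Haar.Unique
import HarnessLib

/-!
# The PCT identity from weak local commutativity at wedge Jost points (function-theoretic core)

Topic `Literature/MathematicalPhysics/QuantumLattice` (trunk T-AQFT). The analytic heart of the
PCT theorem for fields of arbitrary spin (Streater–Wightman (1964), §4-3, Thm. 4-7: "weak local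
commutativity at Jost points ⇒ PCT condition"), in a form that uses only the one-parameter complex
boosts of `TubeBoostReflectionN` instead of the Bargmann–Hall–Wightman theorem, and no quantum
field theory at all.

**Setting.** `F, H : (ℂ⁴)ⁿ → (ι → ℂ)` (finitely many components) are holomorphic on the relative
forward tube `𝒯ʳₙ` with distributional boundary values `T₁`, `T₃` (componentwise, from `𝒯ₙ`); both
are covariant under the real boosts in the `(0,3)`-plane with the same entire one-parameter group
`M`, `F(B(χ)z) = M(χ)F(z)`; `F` is covariant under the rotation `R` by `π` about the third axis,
`F(Rz) = M_R F(z)`, with `M_R` invertible and commuting with `M`. In the application `F` is the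
holomorphic Wightman function of `φ₁ ⋯ φₙ`, `H(z) = G(−zₙ₋₁, …, −z₀)` with `G` that of `φₙ ⋯ φ₁`, so
that `T₃(x) = 𝒲_{n⋯1}(−xₙ₋₁, …, −x₀)` is the PCT-transformed distribution, and **weak local
commutativity** at the (left) wedge configurations reads `T₁(−y) = σ T₃(y)` for `y` in the open set
`𝒥⁺ = {y | y_k − y_{k−1} ∈ W_R}` of right-wedge configurations, i.e.
`T₁(φ(−·)) = σ T₃(φ)` for test functions supported in `𝒥⁺` (hypothesis `hWLC`).

**Conclusion** (`TubeBoost.pct_core`): `F(z) = σ · M(−iπ) M_R⁻¹ H(z)` on `𝒯ₙ` — the PCT identity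
between the holomorphic functions, with the matrix `M(−iπ) M_R⁻¹` ("`S(−1 ∈ L₊(ℂ))⁻¹`",
Streater–Wightman's `(−1)^J`, eqs. (4-31)–(4-35)).

**Proof** (S–W pp. 129–130 with the extended tube replaced by the two wedges): at a real
right-wedge configuration `y` the distributions are real-analytic functions — `T₃ = H♯`,
`T₁ = F♯` near `𝒥⁺` and `T₁ = F♭` near `−𝒥⁺` (`wedgeExtensionN/NegN` and
`HasDistributionalBoundaryValue.eq_integral_of_continuousOn`); WLC becomes the pointwise identity
`F♭(−y) = σ H♯(y)` (fundamental lemma of the calculus of variations); and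
`−y = R (B(iπ) y)` gives `F♭(−y) = M_R M(iπ) F♯(y)` (rotation covariance of `F♭` and the reflection
identity `F♭ ∘ B(iπ) = M(iπ) F♯`). Hence `F♯ = σ M(−iπ) M_R⁻¹ H♯` on `𝒥⁺`, so the holomorphic
function `F − σ M(−iπ) M_R⁻¹ H` on `𝒯ₙ` has vanishing boundary values on the open real set `𝒥⁺`
and vanishes by the local uniqueness theorem (S–W Thm. 2-17,
`eq_zero_of_rayBoundaryValue_zero_of_isOpen`).

## References

* R. F. Streater, A. S. Wightman, *PCT, Spin and Statistics, and All That* (1964; Princeton 2000),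
  §4-3 Thm. 4-7 and its proof, eqs. (4-29)–(4-35); Thm. 2-17. [StreaterWightman1964]
* R. Jost, *Eine Bemerkung zum CTP Theorem*, Helv. Phys. Acta 30 (1957) 409–416.
-/

noncomputable section

open Complex Set Filter MeasureTheory
open _root_.Topology
open scoped Real SchwartzMap

namespace Literature.MathematicalPhysics.QuantumLattice

namespace TubeBoost

variable {n : ℕ}

/-! ### Real wedge configurations and reflected test functions -/

/-- The **right-wedge configurations** `𝒥⁺`: real `x = (x₀, …, x_{n−1})` all of whose successive
differences `x_k − x_{k−1}` (`k ≥ 1`) lie in the right spacelike wedge `W_R = {ξ³ > |ξ⁰|}`. These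
are Jost points (every difference, and every sum of consecutive differences, is spacelike).
[cite: StreaterWightman1964, §2-4 Thm 2-12] -/
def rightWedgeConfigs : Set (Fin n → SpaceTime 3) :=
  {x | ∀ k : Fin n, 0 < (k : ℕ) → |succDiff x k 0| < succDiff x k 3}

/-- Continuity of a successive difference of real configurations. [folklore] -/
theorem continuous_succDiff_real (k : Fin n) : Continuous fun x : Fin n → SpaceTime 3 => succDiff x k :=
  (continuous_apply k).sub ((continuous_apply _).comp
    (continuous_pi fun j => by
      refine Fin.cases ?_ (fun i => ?_) j
      · simpa using continuous_const
      · simpa using continuous_apply i))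

/-- `𝒥⁺` is open. [folklore] -/
theorem isOpen_rightWedgeConfigs : IsOpen (rightWedgeConfigs (n := n)) := by
  have h : rightWedgeConfigs (n := n) =
      ⋂ k : Fin n, {x : Fin n → SpaceTime 3 | 0 < (k : ℕ) → |succDiff x k 0| < succDiff x k 3} := by
    ext x; simp [rightWedgeConfigs]
  rw [h]
  refine isOpen_iInter_of_finite fun k => ?_
  by_cases hk : 0 < (k : ℕ)
  · simp only [hk, forall_true_left]
    have h0 : Continuous fun x : Fin n → SpaceTime 3 => succDiff x k 0 :=
      (PiLp.continuous_apply 2 _ 0).comp (continuous_succDiff_real k)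
    have h3 : Continuous fun x : Fin n → SpaceTime 3 => succDiff x k 3 :=
      (PiLp.continuous_apply 2 _ 3).comp (continuous_succDiff_real k)
    exact isOpen_lt h0.abs h3
  · simp only [hk, IsEmpty.forall_iff, setOf_true, isOpen_univ]

/-- `𝒥⁺` is nonempty: `x_k = (k + 1) e₃`. [folklore] -/
theorem rightWedgeConfigs_nonempty : (rightWedgeConfigs (n := n)).Nonempty := by
  refine ⟨fun k => (((k : ℕ) : ℝ) + 1) • EuclideanSpace.single (3 : Fin (3 + 1)) (1 : ℝ), fun k hk => ?_⟩
  cases n with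
  | zero => exact k.elim0
  | succ m =>
    obtain ⟨j, rfl⟩ := Fin.exists_succ_eq.2 (Fin.pos_iff_ne_zero.1 hk)
    rw [succDiff_succ]
    simp [Fin.val_succ]

/-- The **reflection `φ ↦ φ(−·)` of test functions on configurations** (the test-function side of
the total inversion `x ↦ −x` applied to every variable). [folklore] -/
def reflectConfigTest : 𝓢((Fin n → SpaceTime 3), ℂ) →L[ℂ] 𝓢((Fin n → SpaceTime 3), ℂ) :=
  SchwartzMap.compCLMOfContinuousLinearEquiv ℂ (ContinuousLinearEquiv.neg ℝ)

/-- Pointwise formula: `reflectConfigTest φ x = φ (−x)`. [folklore] -/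
@[simp] theorem reflectConfigTest_apply (φ : 𝓢((Fin n → SpaceTime 3), ℂ)) (x : Fin n → SpaceTime 3) :
    reflectConfigTest φ x = φ (-x) := rfl

/-- The reflection preserves compact support. [folklore] -/
theorem hasCompactSupport_reflectConfigTest {φ : 𝓢((Fin n → SpaceTime 3), ℂ)}
    (hφ : HasCompactSupport (φ : (Fin n → SpaceTime 3) → ℂ)) :
    HasCompactSupport (reflectConfigTest φ : (Fin n → SpaceTime 3) → ℂ) := by
  show HasCompactSupport fun x => φ (-x)
  exact hφ.comp_homeomorph (Homeomorph.neg (Fin n → SpaceTime 3))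

/-- The support of the reflected test function is the reflected support. [folklore] -/
theorem tsupport_reflectConfigTest_subset (φ : 𝓢((Fin n → SpaceTime 3), ℂ)) :
    tsupport (reflectConfigTest φ : (Fin n → SpaceTime 3) → ℂ) ⊆
      (fun x => -x) ⁻¹' tsupport (φ : (Fin n → SpaceTime 3) → ℂ) :=
  tsupport_comp_subset_preimage (φ : (Fin n → SpaceTime 3) → ℂ) continuous_neg

/-! ### The complexification of `−x` and of wedge configurations -/

/-- `complexifyConfig (−x) = −complexifyConfig x`. [folklore] -/
theorem complexifyConfig_neg (x : Fin n → SpaceTime 3) : complexifyConfig (-x) = -complexifyConfig x := by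
  funext k μ; simp [complexifyPoint_apply]

/-- Continuity of `complexifyConfig`. [folklore] -/
theorem continuous_complexifyConfig : Continuous (complexifyConfig (n := n)) :=
  continuous_pi fun k => continuous_complexifyPoint.comp (continuous_apply k)

/-- A right-wedge configuration complexifies into the right-wedge domain. [folklore] -/
theorem complexifyConfig_mem_wedgeDomainN_of_mem {x : Fin n → SpaceTime 3} (hx : x ∈ rightWedgeConfigs) :
    complexifyConfig x ∈ wedgeDomainN :=
  complexifyConfig_mem_wedgeDomainN hx

/-- The negative of a right-wedge configuration complexifies into the left-wedge domain. [folklore] -/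
theorem complexifyConfig_neg_mem_wedgeDomainNegN_of_mem {x : Fin n → SpaceTime 3} (hx : x ∈ rightWedgeConfigs) :
    complexifyConfig (-x) ∈ wedgeDomainNegN := by
  refine complexifyConfig_mem_wedgeDomainNegN fun k hk => ?_
  have h := hx k hk
  have hneg : succDiff (-x) k = -succDiff x k := by
    have := succDiff_map (fun p : SpaceTime 3 => -p) (fun a b => by abel) x k
    exact this
  rw [hneg]
  simpa using h

/-- **`−y = R (B(iπ) y)`**: the total inversion is the real rotation by `π` about the third axis
composed with the (real) boost of imaginary rapidity `iπ`. [cite: StreaterWightman1964, §4-3 eq. (4-31)] -/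
theorem rot3N_boostN_pi_mul_I (z : Fin n → Fin (3 + 1) → ℂ) : rot3N (boostN (π * I) z) = -z := by
  funext k μ
  simp only [rot3N_apply, boostN_apply, Pi.neg_apply, boost_pi_mul_I_apply, rot3]
  fin_cases μ <;> simp

/-! ### The fundamental lemma for continuous functions against compactly supported Schwartz tests -/

/-- **A continuous function orthogonal to all compactly supported test functions supported in an
open set vanishes there** (fundamental lemma of the calculus of variations, through Mathlib's
`IsOpen.ae_eq_zero_of_integral_contDiff_smul_eq_zero`). [folklore] -/
theorem eqOn_zero_of_forall_integral_mul_eq_zero {g : (Fin n → SpaceTime 3) → ℂ} {O : Set (Fin n → SpaceTime 3)}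
    (hO : IsOpen O) (hg : ContinuousOn g O)
    (h : ∀ φ : 𝓢((Fin n → SpaceTime 3), ℂ), HasCompactSupport (φ : (Fin n → SpaceTime 3) → ℂ) →
      tsupport (φ : (Fin n → SpaceTime 3) → ℂ) ⊆ O → ∫ x, g x * φ x = 0) :
    ∀ x ∈ O, g x = 0 := by
  -- a.e. vanishing on `O`
  have hae : ∀ᵐ x ∂(volume : Measure (Fin n → SpaceTime 3)), x ∈ O → g x = 0 := by
    refine hO.ae_eq_zero_of_integral_contDiff_smul_eq_zero (hg.locallyIntegrableOn hO.measurableSet) ?_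
    intro ψ hψ hψc hψO
    have hψc' : HasCompactSupport fun x => (ψ x : ℂ) := hψc.comp_left Complex.ofReal_zero
    have hψs : ContDiff ℝ (⊤ : ℕ∞) fun x => (ψ x : ℂ) := Complex.ofRealCLM.contDiff.comp hψ
    have h1 := h (hψc'.toSchwartzMap hψs) hψc' ((tsupport_comp_subset Complex.ofReal_zero _).trans hψO)
    have h2 : (fun x => g x * (hψc'.toSchwartzMap hψs) x) = fun x => ψ x • g x := by
      funext x
      rw [HasCompactSupport.toSchwartzMap_toFun, Complex.real_smul, mul_comm]
    rwa [h2] at h1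
  -- continuity upgrades a.e. to everywhere on the open set
  intro x hx
  by_contra hne
  have hopen : IsOpen (O ∩ {y | g y ≠ 0}) := hg.isOpen_inter_preimage hO isOpen_ne
  have hpos : 0 < (volume : Measure (Fin n → SpaceTime 3)) (O ∩ {y | g y ≠ 0}) :=
    hopen.measure_pos volume ⟨x, hx, hne⟩
  have hzero : (volume : Measure (Fin n → SpaceTime 3)) (O ∩ {y | g y ≠ 0}) = 0 := by
    rw [measure_eq_zero_iff_ae_notMem]
    filter_upwards [hae] with y hy hmem
    exact hmem.2 (hy hmem.1)
  exact hpos.ne' hzero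

/-- A product `g · φ` is integrable when `φ` is a compactly supported test function supported in an open
set on which `g` is continuous. [folklore] -/
theorem integrable_mul_of_continuousOn_tsupport {g : (Fin n → SpaceTime 3) → ℂ} {O : Set (Fin n → SpaceTime 3)}
    (hO : IsOpen O) (hg : ContinuousOn g O) (φ : 𝓢((Fin n → SpaceTime 3), ℂ))
    (hφ : HasCompactSupport (φ : (Fin n → SpaceTime 3) → ℂ))
    (hφO : tsupport (φ : (Fin n → SpaceTime 3) → ℂ) ⊆ O) :
    Integrable (fun x => g x * φ x) (volume : Measure (Fin n → SpaceTime 3)) := by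
  have hc : Continuous fun x => g x * φ x := by
    refine continuous_iff_continuousAt.2 fun x => ?_
    by_cases hx : x ∈ tsupport (φ : (Fin n → SpaceTime 3) → ℂ)
    · exact (hg.continuousAt (hO.mem_nhds (hφO hx))).mul φ.continuous.continuousAt
    · have h0 : (φ : (Fin n → SpaceTime 3) → ℂ) =ᶠ[𝓝 x] 0 := notMem_tsupport_iff_eventuallyEq.1 hx
      have h1 : (fun y => g y * φ y) =ᶠ[𝓝 x] fun _ => 0 := by
        filter_upwards [h0] with y hy
        simp [hy]
      exact continuousAt_const.congr h1.symm
  exact hc.integrable_of_hasCompactSupport hφ.mul_left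

/-! ### Boundary values at wedge configurations are the values of the wedge extensions -/

section BV

variable {ι : Type*} [Fintype ι]

/-- **At real points of a set where a continuous extension exists, the distributional boundary value
is that extension**: if `𝔚` (holomorphic on `𝒯ʳₙ`, boundary value `T` from `𝒯ₙ`) agrees on
`U ∩ 𝒯ʳₙ` with a function `𝔚♯` continuous on the open set `U`, then `T(φ) = ∫ 𝔚♯(x) φ(x) dx` for
every compactly supported test function whose (complexified) support lies in `U`. (Apply
`HasDistributionalBoundaryValue.eq_integral_of_continuousOn` to the glued function.)
[cite: StreaterWightman1964, §4-3 proof of Thm 4-7] -/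
theorem apply_eq_integral_of_extension {𝔚 𝔚' : (Fin n → Fin (3 + 1) → ℂ) → ℂ}
    {T : 𝓢((Fin n → SpaceTime 3), ℂ) →L[ℂ] ℂ} (hbv : HasDistributionalBoundaryValue 𝔚 T)
    {U : Set (Fin n → Fin (3 + 1) → ℂ)} (hU : IsOpen U) (h𝔚' : ContinuousOn 𝔚' U)
    (heq : ∀ z ∈ U, z ∈ QuantumFieldTheory.relForwardTube 3 n → 𝔚' z = 𝔚 z)
    (φ : 𝓢((Fin n → SpaceTime 3), ℂ)) (hφ : HasCompactSupport (φ : (Fin n → SpaceTime 3) → ℂ))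
    (hφU : ∀ x ∈ tsupport (φ : (Fin n → SpaceTime 3) → ℂ), complexifyConfig x ∈ U) :
    T φ = ∫ x, 𝔚' (complexifyConfig x) * φ x := by
  classical
  -- the glued function
  set G : (Fin n → Fin (3 + 1) → ℂ) → ℂ := fun z =>
    if z ∈ QuantumFieldTheory.relForwardTube 3 n then 𝔚 z else 𝔚' z with hG
  have hGeq : EqOn G 𝔚 (forwardTube 3 n) := fun z hz => by
    simp [hG, QuantumFieldTheory.forwardTube_subset_relForwardTube hz]
  have hGbv : HasDistributionalBoundaryValue G T := hbv.congr_of_eqOn_forwardTube hGeq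
  have hGU : EqOn G 𝔚' U := fun z hz => by
    by_cases h : z ∈ QuantumFieldTheory.relForwardTube 3 n
    · simp [hG, h, heq z hz h]
    · simp [hG, h]
  have hGc : ContinuousOn G U := h𝔚'.congr hGU
  have h := hGbv.eq_integral_of_continuousOn hU hGc φ hφ (fun x hx => hφU x hx)
  rw [h]
  refine integral_congr_ae (Eventually.of_forall fun x => ?_)
  by_cases hx : x ∈ tsupport (φ : (Fin n → SpaceTime 3) → ℂ)
  · simp only
    rw [show (fun k => complexifyPoint (x k)) = complexifyConfig x from rfl, hGU (hφU x hx)]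
  · simp only [image_eq_zero_of_notMem_tsupport hx, mul_zero]

variable {M : ℂ → (ι → ℂ) →L[ℂ] (ι → ℂ)} {F : (Fin n → Fin (3 + 1) → ℂ) → (ι → ℂ)}
  {T : ι → (𝓢((Fin n → SpaceTime 3), ℂ) →L[ℂ] ℂ)}

/-- **On right-wedge configurations the boundary value is `F♯`.** [cite: StreaterWightman1964, §4-3 proof of Thm 4-7] -/
theorem apply_eq_integral_wedgeExtensionN
    (hF : DifferentiableOn ℂ F (QuantumFieldTheory.relForwardTube 3 n))
    (hbv : ∀ a, HasDistributionalBoundaryValue (fun z => F z a) (T a))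
    (hM : Differentiable ℂ M) (hM0 : M 0 = 1) (hMadd : ∀ a b, M (a + b) = M a * M b)
    (hcov : ∀ (χ : ℝ), ∀ z ∈ QuantumFieldTheory.relForwardTube 3 n, F (boostN χ z) = M χ (F z))
    (a : ι) (φ : 𝓢((Fin n → SpaceTime 3), ℂ)) (hφ : HasCompactSupport (φ : (Fin n → SpaceTime 3) → ℂ))
    (hφO : tsupport (φ : (Fin n → SpaceTime 3) → ℂ) ⊆ rightWedgeConfigs) :
    T a φ = ∫ x, wedgeExtensionN M F (complexifyConfig x) a * φ x := by
  refine apply_eq_integral_of_extension (𝔚' := fun z => wedgeExtensionN M F z a) (hbv a) isOpen_wedgeDomainN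
    ?_ ?_ φ hφ (fun x hx => complexifyConfig_mem_wedgeDomainN_of_mem (hφO hx))
  · exact (continuous_apply a).comp_continuousOn (differentiableOn_wedgeExtensionN hF).continuousOn
  · intro z hz hz'
    show wedgeExtensionN M F z a = F z a
    rw [wedgeExtensionN_eq_of_mem hF hM hM0 hMadd hcov hz hz']

/-- **Near `−𝒥⁺` the boundary value is `F♭`**, in reflected form: for `φ` supported in `𝒥⁺`,
`T(φ(−·)) = ∫ F♭(−y) φ(y) dy`. [cite: StreaterWightman1964, §4-3 proof of Thm 4-7] -/
theorem apply_reflect_eq_integral_wedgeExtensionNegN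
    (hF : DifferentiableOn ℂ F (QuantumFieldTheory.relForwardTube 3 n))
    (hbv : ∀ a, HasDistributionalBoundaryValue (fun z => F z a) (T a))
    (hM : Differentiable ℂ M) (hM0 : M 0 = 1) (hMadd : ∀ a b, M (a + b) = M a * M b)
    (hcov : ∀ (χ : ℝ), ∀ z ∈ QuantumFieldTheory.relForwardTube 3 n, F (boostN χ z) = M χ (F z))
    (a : ι) (φ : 𝓢((Fin n → SpaceTime 3), ℂ)) (hφ : HasCompactSupport (φ : (Fin n → SpaceTime 3) → ℂ))
    (hφO : tsupport (φ : (Fin n → SpaceTime 3) → ℂ) ⊆ rightWedgeConfigs) :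
    T a (reflectConfigTest φ) = ∫ y, wedgeExtensionNegN M F (complexifyConfig (-y)) a * φ y := by
  have hsupp : ∀ x ∈ tsupport (reflectConfigTest φ : (Fin n → SpaceTime 3) → ℂ), -x ∈ rightWedgeConfigs :=
    fun x hx => hφO (tsupport_reflectConfigTest_subset φ hx)
  have h := apply_eq_integral_of_extension (𝔚' := fun z => wedgeExtensionNegN M F z a) (hbv a)
    isOpen_wedgeDomainNegN
    ((continuous_apply a).comp_continuousOn (differentiableOn_wedgeExtensionNegN hF hMadd).continuousOn)
    (fun z hz hz' => by
      show wedgeExtensionNegN M F z a = F z a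
      rw [wedgeExtensionNegN_eq_of_mem hF hM hM0 hMadd hcov hz hz'])
    (reflectConfigTest φ) (hasCompactSupport_reflectConfigTest hφ)
    (fun x hx => by
      have := complexifyConfig_neg_mem_wedgeDomainNegN_of_mem (hsupp x hx)
      rwa [neg_neg] at this)
  haveI : (volume : Measure (Fin n → SpaceTime 3)).IsNegInvariant := Pi.isNegInvariant_volume
  rw [h, ← integral_neg_eq_self _ volume]
  refine integral_congr_ae (Eventually.of_forall fun y => ?_)
  simp only [reflectConfigTest_apply, neg_neg]

end BV

/-! ### The PCT identity -/

section Main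

variable {ι : Type*} [Fintype ι] [DecidableEq ι]

/-- Matrix entries of a linear map on `ι → ℂ`: `(C v) a = ∑_b v b · C (e_b) a`. [folklore] -/
theorem clm_apply_eq_sum (C : (ι → ℂ) →L[ℂ] (ι → ℂ)) (v : ι → ℂ) (a : ι) :
    C v a = ∑ b, v b * C (Pi.single b 1) a := by
  have h : v = ∑ b, v b • (Pi.single b (1 : ℂ) : ι → ℂ) := by
    funext a
    simp [Finset.sum_apply, Pi.single_apply, Finset.sum_ite_eq]
  conv_lhs => rw [h]
  simp [map_sum, map_smul, Finset.sum_apply]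

/-- **The PCT identity from weak local commutativity near one wedge Jost point** (Streater–Wightman
(1964), Thm. 4-7, function-theoretic core; see the module docstring): it suffices that weak local
commutativity `T₁(φ(−·)) = σ T₃(φ)` hold for the test functions supported in some nonempty open set
`O` of right-wedge configurations. Conclusion: `F = σ · M(−iπ) M_R⁻¹ H` on the forward tube `𝒯ₙ`.
[cite: StreaterWightman1964, §4-3 Thm 4-7] -/
theorem pct_core_local {F H : (Fin n → Fin (3 + 1) → ℂ) → (ι → ℂ)}
    (hF : DifferentiableOn ℂ F (QuantumFieldTheory.relForwardTube 3 n))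
    (hH : DifferentiableOn ℂ H (QuantumFieldTheory.relForwardTube 3 n))
    {T₁ T₃ : ι → (𝓢((Fin n → SpaceTime 3), ℂ) →L[ℂ] ℂ)}
    (hbv₁ : ∀ a, HasDistributionalBoundaryValue (fun z => F z a) (T₁ a))
    (hbv₃ : ∀ a, HasDistributionalBoundaryValue (fun z => H z a) (T₃ a))
    {M : ℂ → (ι → ℂ) →L[ℂ] (ι → ℂ)} (hM : Differentiable ℂ M) (hM0 : M 0 = 1)
    (hMadd : ∀ a b, M (a + b) = M a * M b)
    (hcovF : ∀ (χ : ℝ), ∀ z ∈ QuantumFieldTheory.relForwardTube 3 n, F (boostN χ z) = M χ (F z))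
    (hcovH : ∀ (χ : ℝ), ∀ z ∈ QuantumFieldTheory.relForwardTube 3 n, H (boostN χ z) = M χ (H z))
    {MR MRinv : (ι → ℂ) →L[ℂ] (ι → ℂ)} (hMR' : MRinv * MR = 1)
    (hrotF : ∀ z ∈ QuantumFieldTheory.relForwardTube 3 n, F (rot3N z) = MR (F z))
    (hcomm : ∀ w : ℂ, M w * MR = MR * M w)
    (σ : ℂ) {O : Set (Fin n → SpaceTime 3)} (hO : IsOpen O) (hOne : O.Nonempty) (hOsub : O ⊆ rightWedgeConfigs)
    (hWLC : ∀ φ : 𝓢((Fin n → SpaceTime 3), ℂ), HasCompactSupport (φ : (Fin n → SpaceTime 3) → ℂ) →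
      tsupport (φ : (Fin n → SpaceTime 3) → ℂ) ⊆ O →
      ∀ a, T₁ a (reflectConfigTest φ) = σ * T₃ a φ)
    {z : Fin n → Fin (3 + 1) → ℂ} (hz : z ∈ forwardTube 3 n) :
    F z = σ • M (-(π * I)) (MRinv (H z)) := by
  -- the candidate matrix `C = M(−iπ) M_R⁻¹`
  set C : (ι → ℂ) →L[ℂ] (ι → ℂ) := M (-(π * I)) * MRinv with hC
  -- Step 1: pointwise WLC on `O`: `F♭(−y) = σ H♯(y)`
  have hpt : ∀ y ∈ O, ∀ a,
      wedgeExtensionNegN M F (complexifyConfig (-y)) a = σ * wedgeExtensionN M H (complexifyConfig y) a := by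
    intro y hy a
    have hcontNeg : ContinuousOn (fun y : Fin n → SpaceTime 3 => wedgeExtensionNegN M F (complexifyConfig (-y)) a) O := by
      refine ((continuous_apply a).comp_continuousOn
        ((differentiableOn_wedgeExtensionNegN hF hMadd).continuousOn)).comp
        (continuous_complexifyConfig.comp continuous_neg).continuousOn ?_
      exact fun y hy => complexifyConfig_neg_mem_wedgeDomainNegN_of_mem (hOsub hy)
    have hcontPos : ContinuousOn (fun y : Fin n → SpaceTime 3 => wedgeExtensionN M H (complexifyConfig y) a) O := by
      refine ((continuous_apply a).comp_continuousOn
        ((differentiableOn_wedgeExtensionN hH).continuousOn)).comp continuous_complexifyConfig.continuousOn ?_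
      exact fun y hy => complexifyConfig_mem_wedgeDomainN_of_mem (hOsub hy)
    have key := eqOn_zero_of_forall_integral_mul_eq_zero hO
      (hcontNeg.sub (hcontPos.const_smul σ)) (fun φ hφ hφO => ?_) y hy
    · simpa [sub_eq_zero] using key
    · -- `∫ (F♭(−y) − σ H♯(y)) φ(y) dy = T₁(φ(−·)) − σ T₃(φ) = 0`
      have h1 := apply_reflect_eq_integral_wedgeExtensionNegN hF hbv₁ hM hM0 hMadd hcovF a φ hφ (hφO.trans hOsub)
      have h3 := apply_eq_integral_wedgeExtensionN hH hbv₃ hM hM0 hMadd hcovH a φ hφ (hφO.trans hOsub)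
      have hint₁ : Integrable fun y : Fin n → SpaceTime 3 => wedgeExtensionNegN M F (complexifyConfig (-y)) a * φ y :=
        integrable_mul_of_continuousOn_tsupport hO hcontNeg φ hφ hφO
      have hint₃ : Integrable fun y : Fin n → SpaceTime 3 => wedgeExtensionN M H (complexifyConfig y) a * φ y :=
        integrable_mul_of_continuousOn_tsupport hO hcontPos φ hφ hφO
      have e : (fun y : Fin n → SpaceTime 3 => (wedgeExtensionNegN M F (complexifyConfig (-y)) a -
          σ • wedgeExtensionN M H (complexifyConfig y) a) * φ y) =
          fun y => wedgeExtensionNegN M F (complexifyConfig (-y)) a * φ y -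
            σ * (wedgeExtensionN M H (complexifyConfig y) a * φ y) := by
        funext y; simp only [smul_eq_mul]; ring
      show ∫ y, (wedgeExtensionNegN M F (complexifyConfig (-y)) a - σ • wedgeExtensionN M H (complexifyConfig y) a) * φ y = 0
      rw [e, integral_sub hint₁ (hint₃.const_mul σ), integral_const_mul, ← h1, ← h3, hWLC φ hφ hφO a, sub_self]
  -- Step 2: algebra at wedge points: `F♯(y) = σ C H♯(y)` on `O`
  have hptvec : ∀ y ∈ O,
      wedgeExtensionN M F (complexifyConfig y) = σ • C (wedgeExtensionN M H (complexifyConfig y)) := by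
    intro y hy
    have hyW : complexifyConfig y ∈ wedgeDomainN := complexifyConfig_mem_wedgeDomainN_of_mem (hOsub hy)
    -- `F♭(−y) = M_R M(iπ) F♯(y)`
    have hrefl : wedgeExtensionNegN M F (complexifyConfig (-y)) =
        MR (M (π * I) (wedgeExtensionN M F (complexifyConfig y))) := by
      rw [complexifyConfig_neg, ← rot3N_boostN_pi_mul_I,
        wedgeExtensionNegN_rot3N hMadd hrotF (hcomm _) (hcomm _)
          ((boostN_pi_mul_I_mem_wedgeDomainNegN_iff _).2 hyW),
        wedgeExtensionNegN_boostN_pi_mul_I hMadd]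
    have hvec : wedgeExtensionNegN M F (complexifyConfig (-y)) = σ • wedgeExtensionN M H (complexifyConfig y) := by
      funext a; rw [hpt y hy a]; rfl
    rw [hrefl] at hvec
    -- invert `M_R M(iπ)`
    have hinvM : M (-(π * I)) * M (π * I) = 1 := by rw [← hMadd, neg_add_cancel, hM0]
    calc wedgeExtensionN M F (complexifyConfig y)
        = (M (-(π * I)) * MRinv * (MR * M (π * I))) (wedgeExtensionN M F (complexifyConfig y)) := by
          rw [mul_assoc, ← mul_assoc MRinv, hMR', one_mul, hinvM]; rfl
      _ = C (MR (M (π * I) (wedgeExtensionN M F (complexifyConfig y)))) := by rw [hC]; rfl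
      _ = C (σ • wedgeExtensionN M H (complexifyConfig y)) := by rw [hvec]
      _ = σ • C (wedgeExtensionN M H (complexifyConfig y)) := by rw [map_smul]
  -- Step 3: the difference `D = F − σ C H` has vanishing boundary values on `O`, hence vanishes on `𝒯ₙ`
  have hD : ∀ a, ∀ z ∈ forwardTube 3 n, (F z a - σ * C (H z) a) = 0 := by
    intro a
    refine fun z hz => eq_zero_of_rayBoundaryValue_zero_of_isOpen (G := fun z => F z a - σ * C (H z) a) ?_
      hO hOne ?_ hz
    · -- holomorphy on `𝒯ₙ`
      have hF' := hF.mono (QuantumFieldTheory.forwardTube_subset_relForwardTube (d := 3) (n := n))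
      have hH' := hH.mono (QuantumFieldTheory.forwardTube_subset_relForwardTube (d := 3) (n := n))
      have h1 : DifferentiableOn ℂ (fun z => F z a) (forwardTube 3 n) := fun z hz =>
        (ContinuousLinearMap.proj a : (ι → ℂ) →L[ℂ] ℂ).differentiableAt.comp_differentiableWithinAt z (hF' z hz)
      have h2 : DifferentiableOn ℂ (fun z => C (H z) a) (forwardTube 3 n) := fun z hz =>
        ((ContinuousLinearMap.proj a : (ι → ℂ) →L[ℂ] ℂ).comp C).differentiableAt.comp_differentiableWithinAt z
          (hH' z hz)
      exact h1.sub (h2.const_mul σ)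
    · -- ray boundary values on tests supported in `O`
      intro η hη φ hφ hφO
      have hray : ∀ t : ℝ, 0 < t → ∀ x : Fin n → SpaceTime 3,
          (fun k => complexifyPoint (x k) + ((t : ℂ) * I) • complexifyPoint (η k)) ∈ forwardTube 3 n :=
        fun t ht x => mem_forwardTube_of_mem_tubeCone x η hη ht
      -- continuity of the ray slices
      have hcontF : ∀ t : ℝ, 0 < t → Continuous fun x : Fin n → SpaceTime 3 =>
          F (fun k => complexifyPoint (x k) + ((t : ℂ) * I) • complexifyPoint (η k)) := by
        intro t ht
        have hr : Continuous fun x : Fin n → SpaceTime 3 =>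
            (fun k => complexifyPoint (x k) + ((t : ℂ) * I) • complexifyPoint (η k)) :=
          continuous_pi fun k => (continuous_complexifyPoint.comp (continuous_apply k)).add continuous_const
        refine (hF.continuousOn.comp_continuous hr fun x => ?_)
        exact QuantumFieldTheory.forwardTube_subset_relForwardTube (hray t ht x)
      have hcontH : ∀ t : ℝ, 0 < t → Continuous fun x : Fin n → SpaceTime 3 =>
          H (fun k => complexifyPoint (x k) + ((t : ℂ) * I) • complexifyPoint (η k)) := by
        intro t ht
        have hr : Continuous fun x : Fin n → SpaceTime 3 =>
            (fun k => complexifyPoint (x k) + ((t : ℂ) * I) • complexifyPoint (η k)) :=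
          continuous_pi fun k => (continuous_complexifyPoint.comp (continuous_apply k)).add continuous_const
        refine (hH.continuousOn.comp_continuous hr fun x => ?_)
        exact QuantumFieldTheory.forwardTube_subset_relForwardTube (hray t ht x)
      -- the limit of `∫ D φ` is `T₁ a φ − σ ∑_b C_ab T₃ b φ`
      have hlimF := hbv₁ a η hη φ
      have hlimH : ∀ b, Tendsto (fun t : ℝ => ∫ x : Fin n → SpaceTime 3,
          H (fun k => complexifyPoint (x k) + ((t : ℂ) * I) • complexifyPoint (η k)) b * φ x)
          (𝓝[>] 0) (𝓝 (T₃ b φ)) := fun b => hbv₃ b η hη φ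
      have hlimD : Tendsto (fun t : ℝ => ∫ x : Fin n → SpaceTime 3,
          (F (fun k => complexifyPoint (x k) + ((t : ℂ) * I) • complexifyPoint (η k)) a -
            σ * C (H (fun k => complexifyPoint (x k) + ((t : ℂ) * I) • complexifyPoint (η k))) a) * φ x)
          (𝓝[>] 0) (𝓝 (T₁ a φ - σ * ∑ b, C (Pi.single b 1) a * T₃ b φ)) := by
        have hsum : Tendsto (fun t : ℝ => ∑ b, C (Pi.single b 1) a * ∫ x : Fin n → SpaceTime 3,
            H (fun k => complexifyPoint (x k) + ((t : ℂ) * I) • complexifyPoint (η k)) b * φ x)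
            (𝓝[>] 0) (𝓝 (∑ b, C (Pi.single b 1) a * T₃ b φ)) :=
          tendsto_finsetSum _ fun b _ => (hlimH b).const_mul _
        have htot := hlimF.sub (hsum.const_mul σ)
        refine htot.congr' ?_
        filter_upwards [self_mem_nhdsWithin] with t ht
        have hiF : Integrable fun x : Fin n → SpaceTime 3 =>
            F (fun k => complexifyPoint (x k) + ((t : ℂ) * I) • complexifyPoint (η k)) a * φ x :=
          (((continuous_apply a).comp (hcontF t ht)).mul φ.continuous).integrable_of_hasCompactSupport
            hφ.mul_left
        have hiH : ∀ b, Integrable fun x : Fin n → SpaceTime 3 =>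
            H (fun k => complexifyPoint (x k) + ((t : ℂ) * I) • complexifyPoint (η k)) b * φ x := fun b =>
          (((continuous_apply b).comp (hcontH t ht)).mul φ.continuous).integrable_of_hasCompactSupport
            hφ.mul_left
        have e : ∀ b, C (Pi.single b 1) a * ∫ x : Fin n → SpaceTime 3,
            H (fun k => complexifyPoint (x k) + ((t : ℂ) * I) • complexifyPoint (η k)) b * φ x =
            ∫ x : Fin n → SpaceTime 3, C (Pi.single b 1) a *
              (H (fun k => complexifyPoint (x k) + ((t : ℂ) * I) • complexifyPoint (η k)) b * φ x) :=
          fun b => (integral_const_mul _ _).symm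
        simp_rw [e]
        rw [← integral_finsetSum _ (fun b _ => (hiH b).const_mul _)]
        rw [← integral_const_mul, ← integral_sub hiF]
        · refine integral_congr_ae (Eventually.of_forall fun x => ?_)
          simp only
          rw [clm_apply_eq_sum C, Finset.mul_sum, Finset.mul_sum, sub_mul, Finset.sum_mul]
          congr 1
          refine Finset.sum_congr rfl fun b _ => ?_
          ring
        · exact (integrable_finsetSum _ fun b _ => (hiH b).const_mul _).const_mul σ
      -- and this limit is `∫ (F♯ − σ C H♯) φ = 0`
      have hval : T₁ a φ - σ * ∑ b, C (Pi.single b 1) a * T₃ b φ = 0 := by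
        have e1 := apply_eq_integral_wedgeExtensionN hF hbv₁ hM hM0 hMadd hcovF a φ hφ (hφO.trans hOsub)
        have e3 : ∀ b, T₃ b φ = ∫ x, wedgeExtensionN M H (complexifyConfig x) b * φ x := fun b =>
          apply_eq_integral_wedgeExtensionN hH hbv₃ hM hM0 hMadd hcovH b φ hφ (hφO.trans hOsub)
        have hcontPos : ∀ b, ContinuousOn (fun y : Fin n → SpaceTime 3 => wedgeExtensionN M H (complexifyConfig y) b) O :=
          fun b => by
          refine ((continuous_apply b).comp_continuousOn
            ((differentiableOn_wedgeExtensionN hH).continuousOn)).comp continuous_complexifyConfig.continuousOn ?_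
          exact fun y hy => complexifyConfig_mem_wedgeDomainN_of_mem (hOsub hy)
        have hcontFs : ContinuousOn (fun y : Fin n → SpaceTime 3 => wedgeExtensionN M F (complexifyConfig y) a) O := by
          refine ((continuous_apply a).comp_continuousOn
            ((differentiableOn_wedgeExtensionN hF).continuousOn)).comp continuous_complexifyConfig.continuousOn ?_
          exact fun y hy => complexifyConfig_mem_wedgeDomainN_of_mem (hOsub hy)
        have hint : ∀ b, Integrable fun y : Fin n → SpaceTime 3 => wedgeExtensionN M H (complexifyConfig y) b * φ y :=
          fun b => integrable_mul_of_continuousOn_tsupport hO (hcontPos b) φ hφ hφO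
        have hintF : Integrable fun y : Fin n → SpaceTime 3 => wedgeExtensionN M F (complexifyConfig y) a * φ y :=
          integrable_mul_of_continuousOn_tsupport hO hcontFs φ hφ hφO
        -- rewrite everything as one integral of a function vanishing on the support
        have hzero : ∀ y, wedgeExtensionN M F (complexifyConfig y) a * φ y -
            σ * ∑ b, C (Pi.single b 1) a * (wedgeExtensionN M H (complexifyConfig y) b * φ y) = 0 := by
          intro y
          by_cases hy : y ∈ tsupport (φ : (Fin n → SpaceTime 3) → ℂ)
          · have h := congrFun (hptvec y (hφO hy)) a
            simp only [Pi.smul_apply, smul_eq_mul] at h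
            rw [h, clm_apply_eq_sum C]
            simp only [Finset.mul_sum, Finset.sum_mul]
            rw [← Finset.sum_sub_distrib]
            exact Finset.sum_eq_zero fun b _ => by ring
          · simp [image_eq_zero_of_notMem_tsupport hy]
        rw [e1, Finset.mul_sum]
        simp_rw [e3]
        rw [show (∑ b, σ * (C (Pi.single b 1) a * ∫ x, wedgeExtensionN M H (complexifyConfig x) b * φ x)) =
            ∫ x, σ * ∑ b, C (Pi.single b 1) a * (wedgeExtensionN M H (complexifyConfig x) b * φ x) by
          rw [integral_const_mul, integral_finsetSum _ (fun b _ => (hint b).const_mul _)]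
          simp_rw [integral_const_mul, Finset.mul_sum]]
        rw [← integral_sub hintF ((integrable_finsetSum _ fun b _ => (hint b).const_mul _).const_mul σ)]
        simp [hzero]
      rw [hval] at hlimD
      exact hlimD
  -- conclusion
  funext a
  have h := hD a z hz
  rw [sub_eq_zero] at h
  rw [h, hC]
  rfl

/-- **The PCT identity from weak local commutativity at wedge Jost points** (Streater–Wightman
(1964), Thm. 4-7, function-theoretic core; see the module docstring for the setting and the proof),
with weak local commutativity on all of `𝒥⁺`. Conclusion: `F = σ · M(−iπ) M_R⁻¹ H` on `𝒯ₙ`.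
[cite: StreaterWightman1964, §4-3 Thm 4-7] -/
theorem pct_core {F H : (Fin n → Fin (3 + 1) → ℂ) → (ι → ℂ)}
    (hF : DifferentiableOn ℂ F (QuantumFieldTheory.relForwardTube 3 n))
    (hH : DifferentiableOn ℂ H (QuantumFieldTheory.relForwardTube 3 n))
    {T₁ T₃ : ι → (𝓢((Fin n → SpaceTime 3), ℂ) →L[ℂ] ℂ)}
    (hbv₁ : ∀ a, HasDistributionalBoundaryValue (fun z => F z a) (T₁ a))
    (hbv₃ : ∀ a, HasDistributionalBoundaryValue (fun z => H z a) (T₃ a))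
    {M : ℂ → (ι → ℂ) →L[ℂ] (ι → ℂ)} (hM : Differentiable ℂ M) (hM0 : M 0 = 1)
    (hMadd : ∀ a b, M (a + b) = M a * M b)
    (hcovF : ∀ (χ : ℝ), ∀ z ∈ QuantumFieldTheory.relForwardTube 3 n, F (boostN χ z) = M χ (F z))
    (hcovH : ∀ (χ : ℝ), ∀ z ∈ QuantumFieldTheory.relForwardTube 3 n, H (boostN χ z) = M χ (H z))
    {MR MRinv : (ι → ℂ) →L[ℂ] (ι → ℂ)} (hMR' : MRinv * MR = 1)
    (hrotF : ∀ z ∈ QuantumFieldTheory.relForwardTube 3 n, F (rot3N z) = MR (F z))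
    (hcomm : ∀ w : ℂ, M w * MR = MR * M w)
    (σ : ℂ)
    (hWLC : ∀ φ : 𝓢((Fin n → SpaceTime 3), ℂ), HasCompactSupport (φ : (Fin n → SpaceTime 3) → ℂ) →
      tsupport (φ : (Fin n → SpaceTime 3) → ℂ) ⊆ rightWedgeConfigs →
      ∀ a, T₁ a (reflectConfigTest φ) = σ * T₃ a φ)
    {z : Fin n → Fin (3 + 1) → ℂ} (hz : z ∈ forwardTube 3 n) :
    F z = σ • M (-(π * I)) (MRinv (H z)) :=
  pct_core_local hF hH hbv₁ hbv₃ hM hM0 hMadd hcovF hcovH hMR' hrotF hcomm σ isOpen_rightWedgeConfigs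
    rightWedgeConfigs_nonempty subset_rfl hWLC hz

end Main

end TubeBoost

end Literature.MathematicalPhysics.QuantumLattice
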